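import Mathlib
import Summits.PneNP.PneNP.Theorems.SymmetryBudgetWindowBarrierESTNormal

/-!
# Entropy support theorem, layer 3: the linkage count

Helper file for stub `entropySupportTheorem` of crux `SymmetryBudget.WindowBarrier`
(item stmt-PneNP-2145, line `bijection-gauge-twin-iso`).

**Setting.** `X ≤ Sym(β)`, a finite family `I` of `X`-invariant `a`-subsets of `β` ("blocks",
`a ≥ 5`), such that `X` acts faithfully on `⋃ I` and, on each block `B ∈ I`, either trivially or
"fully" (every even permutation supported in `B` agrees on `B` with an element of `X`).  Call a
block `B` *good* if some `x ∈ X`, `x ≠ 1`, is trivial on every other block of `I`.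

**`est_linkage_sq_le`**: `|X|² ≤ (a!)^{|I| + #good}`.  (So a group linked across its blocks —
no good block — has only `|X| ≤ (a!)^{|I|/2}`: the square-root saving behind the entropy support
theorem.)  Proof by induction on `|I|`: a block with trivial action is deleted; at a good block we
pass to its pointwise fixator (`|X| ≤ a! · |X'|`, the fixator has one good block less); if every
block is full and none is good, deleting any block `B_j` keeps faithfulness and creates at most one
good block (`EST.good_unique`: two new good blocks `B_i ≠ B_{i'}` would give elements supported on
`B_i ∪ B_j` and `B_{i'} ∪ B_j` inducing `Alt(B_j)`-normal, hence full, subgroups on `B_j`, and a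
non-trivial commutator supported on `B_j` alone).

No definitions (kernel-only helper file).
-/

-- `Summit.PneNP.PneNP.…` duplicates `PneNP` BY DESIGN (single-problem summit).
set_option linter.dupNamespace false

namespace Summit.PneNP.PneNP.Theorems

open Equiv Equiv.Perm MulAction Subgroup
open Literature.GroupTheory.PermutationGroups (perm_apply_inv_self perm_inv_apply_self)
open scoped Classical

namespace EST

variable {β : Type*} [Fintype β] [DecidableEq β]

omit [Fintype β] [DecidableEq β] in
/-- Inverses of elements of an invariant-set-preserving subgroup preserve the set. -/
theorem inv_apply_mem_of_mem {X : Subgroup (Perm β)} {B : Finset β}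
    (hinv : ∀ x ∈ X, ∀ u, x u ∈ B ↔ u ∈ B) {x : Perm β} (hx : x ∈ X) {u : β} (hu : u ∈ B) :
    x⁻¹ u ∈ B := by
  have := hinv x hx (x⁻¹ u)
  rw [perm_apply_inv_self] at this
  exact this.1 hu

omit [Fintype β] [DecidableEq β] in
/-- If `x` fixes `B` pointwise then so does `x⁻¹`. -/
theorem inv_apply_eq_self_of_forall {x : Perm β} {B : Finset β} (h : ∀ u ∈ B, x u = u)
    {u : β} (hu : u ∈ B) : x⁻¹ u = u := by
  rw [Perm.inv_eq_iff_eq]; exact (h u hu).symm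

/-- **At most one new good block.**  In the setting of the module docstring, let `B_j ∈ I` be a
block on which `X` is full and which is not good.  If `B_i, B_{i'} ∈ I ∖ {B_j}` both carry an
element of `X` that is trivial on all blocks other than itself and `B_j` and that moves a point of
`B_j`, then `B_i = B_{i'}`. -/
theorem good_unique (a : ℕ) (ha : 5 ≤ a) (I : Finset (Finset β)) (X : Subgroup (Perm β))
    (hsize : ∀ B ∈ I, B.card = a) (hinv : ∀ x ∈ X, ∀ B ∈ I, ∀ u, x u ∈ B ↔ u ∈ B)
    (Bj : Finset β) (hBj : Bj ∈ I)
    (hfull : ∀ σ : Perm β, sign σ = 1 → (∀ u, σ u ≠ u → u ∈ Bj) → ∃ x ∈ X, ∀ u ∈ Bj, x u = σ u)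
    (hnot : ∀ x ∈ X, (∀ B ∈ I, B ≠ Bj → ∀ u ∈ B, x u = u) → x = 1)
    (Bi Bi' : Finset β) (hBi : Bi ∈ I) (hBi' : Bi' ∈ I) (hij : Bi ≠ Bj) (hi'j : Bi' ≠ Bj)
    (xi : Perm β) (hxi : xi ∈ X) (hxi_triv : ∀ B ∈ I, B ≠ Bi → B ≠ Bj → ∀ u ∈ B, xi u = u)
    (hxi_mv : ∃ u ∈ Bj, xi u ≠ u)
    (xi' : Perm β) (hxi' : xi' ∈ X) (hxi'_triv : ∀ B ∈ I, B ≠ Bi' → B ≠ Bj → ∀ u ∈ B, xi' u = u)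
    (hxi'_mv : ∃ u ∈ Bj, xi' u ≠ u) : Bi = Bi' := by
  by_contra hii'
  have haj : Bj.card = a := hsize Bj hBj
  -- the subgroup of `X` trivial on all blocks other than `C` and `B_j` is full on `B_j`
  have key : ∀ (C : Finset β) (y : Perm β), y ∈ X → (∀ B ∈ I, B ≠ C → B ≠ Bj → ∀ u ∈ B, y u = u) →
      (∃ u ∈ Bj, y u ≠ u) →
      ∀ σ : Perm β, sign σ = 1 → (∀ u, σ u ≠ u → u ∈ Bj) →
        ∃ m ∈ X ⊓ fixingSubgroup (Perm β) {u | ∃ B ∈ I, B ≠ C ∧ B ≠ Bj ∧ u ∈ B},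
          ∀ u ∈ Bj, m u = σ u := by
    intro C y hy hy_triv hy_mv
    set M := X ⊓ fixingSubgroup (Perm β) {u | ∃ B ∈ I, B ≠ C ∧ B ≠ Bj ∧ u ∈ B} with hM
    have hmemM : ∀ m, m ∈ M ↔ m ∈ X ∧ ∀ B ∈ I, B ≠ C → B ≠ Bj → ∀ u ∈ B, m u = u := by
      intro m
      rw [hM, Subgroup.mem_inf, mem_fixingSubgroup_iff]
      constructor
      · rintro ⟨hmX, hm⟩
        exact ⟨hmX, fun B hB hBC hBj u hu => hm u ⟨B, hB, hBC, hBj, hu⟩⟩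
      · rintro ⟨hmX, hm⟩
        refine ⟨hmX, ?_⟩
        rintro u ⟨B, hB, hBC, hBj, hu⟩
        exact hm B hB hBC hBj u hu
    have hdich := est_trivial_or_full_of_normal Bj X M (haj ▸ ha) (fun l hl => hinv l hl Bj hBj)
      (fun m hm => hinv m ((hmemM m).1 hm).1 Bj hBj) hfull (by
        intro l hl m hm
        rw [hmemM] at hm ⊢
        refine ⟨X.mul_mem (X.mul_mem hl hm.1) (X.inv_mem hl), fun B hB hBC hBj u hu => ?_⟩
        have h1 : l⁻¹ u ∈ B := inv_apply_mem_of_mem (fun x hx => hinv x hx B hB) hl hu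
        rw [Perm.mul_apply, Perm.mul_apply, hm.2 B hB hBC hBj _ h1, perm_apply_inv_self])
    rcases hdich with htriv | hfullM
    · exfalso
      obtain ⟨u, hu, hyu⟩ := hy_mv
      exact hyu (htriv y ((hmemM y).2 ⟨hy, hy_triv⟩) u hu)
    · exact hfullM
  -- a 3-cycle on `B_j` not commuting with `xi`, realised by an element `y'` linked to `B_{i'}`
  obtain ⟨u, hu, hxiu⟩ := hxi_mv
  obtain ⟨τ, hτ3, hτB, hτxi⟩ := exists_isThreeCycle_not_commute Bj (by omega) xi u hu hxiu
  obtain ⟨y', hy'M, hy'τ⟩ := key Bi' xi' hxi' hxi'_triv hxi'_mv τ hτ3.sign hτB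
  rw [Subgroup.mem_inf, mem_fixingSubgroup_iff] at hy'M
  obtain ⟨hy'X, hy'fix⟩ := hy'M
  have hy'_triv : ∀ B ∈ I, B ≠ Bi' → B ≠ Bj → ∀ v ∈ B, y' v = v :=
    fun B hB hB1 hB2 v hv => hy'fix v ⟨B, hB, hB1, hB2, hv⟩
  -- the commutator `[xi, y']` is trivial on every block other than `B_j`, hence trivial
  set c := xi * y' * xi⁻¹ * y'⁻¹ with hc
  have hcX : c ∈ X := X.mul_mem (X.mul_mem (X.mul_mem hxi hy'X) (X.inv_mem hxi)) (X.inv_mem hy'X)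
  have hc_triv : ∀ B ∈ I, B ≠ Bj → ∀ v ∈ B, c v = v := by
    intro B hB hBj v hv
    simp only [hc, Perm.mul_apply]
    by_cases hBi : B = Bi
    · subst hBi
      have hy'B : ∀ w ∈ B, y' w = w := hy'_triv B hB hii' hBj
      rw [inv_apply_eq_self_of_forall hy'B hv,
        hy'B _ (inv_apply_mem_of_mem (fun x hx => hinv x hx B hB) hxi hv), perm_apply_inv_self]
    · by_cases hBi' : B = Bi'
      · subst hBi'
        have hxiB : ∀ w ∈ B, xi w = w := hxi_triv B hB (Ne.symm hii') hBj
        have h1 : y'⁻¹ v ∈ B := inv_apply_mem_of_mem (fun x hx => hinv x hx B hB) hy'X hv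
        rw [inv_apply_eq_self_of_forall hxiB h1, perm_apply_inv_self, hxiB v hv]
      · have hxiB : ∀ w ∈ B, xi w = w := hxi_triv B hB hBi hBj
        have hy'B : ∀ w ∈ B, y' w = w := hy'_triv B hB hBi' hBj
        rw [inv_apply_eq_self_of_forall hy'B hv, inv_apply_eq_self_of_forall hxiB hv, hy'B v hv,
          hxiB v hv]
  have hc1 : c = 1 := hnot c hcX hc_triv
  have hcomm : xi * y' = y' * xi := by
    rw [hc, mul_inv_eq_one, mul_inv_eq_iff_eq_mul] at hc1
    exact hc1
  -- hence `τ` commutes with `xi`: contradiction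
  apply hτxi
  ext v
  rw [Perm.mul_apply, Perm.mul_apply]
  by_cases hv : v ∈ Bj
  · have hxiv : xi v ∈ Bj := (hinv xi hxi Bj hBj v).2 hv
    have := congrArg (fun f : Perm β => f v) hcomm
    simp only [Perm.mul_apply] at this
    rw [← hy'τ _ hxiv, ← hy'τ v hv, this]
  · have hxiv : xi v ∉ Bj := fun h => hv ((hinv xi hxi Bj hBj v).1 h)
    rw [apply_eq_self_of_not_mem hτB v hv, apply_eq_self_of_not_mem hτB _ hxiv]

end EST

open EST in
/-- **The linkage count.**  Let `X ≤ Sym(β)` leave every block of a finite family `I` of `a`-sets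
invariant (`a ≥ 5`), act faithfully on their union, and act on each block either trivially or
fully (inducing at least `Alt`).  Then `|X|² ≤ (a!)^{|I| + g}`, where `g` is the number of *good*
blocks: blocks `B` such that some `x ∈ X ∖ {1}` is trivial on every other block of `I`. -/
theorem est_linkage_sq_le :
    ∀ {β : Type*} [Fintype β] [DecidableEq β] (a k : ℕ) (I : Finset (Finset β))
      (X : Subgroup (Equiv.Perm β)),
      5 ≤ a → I.card = k → (∀ B ∈ I, B.card = a) → (∀ x ∈ X, ∀ B ∈ I, ∀ u, x u ∈ B ↔ u ∈ B) →
      (∀ x ∈ X, (∀ B ∈ I, ∀ u ∈ B, x u = u) → x = 1) →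
      (∀ B ∈ I, (∀ x ∈ X, ∀ u ∈ B, x u = u) ∨
        ∀ σ : Equiv.Perm β, Equiv.Perm.sign σ = 1 → (∀ u, σ u ≠ u → u ∈ B) →
          ∃ x ∈ X, ∀ u ∈ B, x u = σ u) →
      Nat.card X ^ 2 ≤ a.factorial ^ (k +
        (I.filter fun B => ∃ x ∈ X, x ≠ 1 ∧ ∀ B' ∈ I, B' ≠ B → ∀ u ∈ B', x u = u).card) := by
  intro β _ _ a k
  induction k with
  | zero =>
    intro I X _ hcard _ _ hfaith _
    have hI : I = ∅ := Finset.card_eq_zero.1 hcard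
    have hX : Nat.card X = 1 := by
      rw [Subgroup.card_eq_one, Subgroup.eq_bot_iff_forall]
      intro x hx
      exact hfaith x hx (by simp [hI])
    rw [hX, one_pow]
    exact Nat.one_le_pow _ _ (Nat.factorial_pos a)
  | succ k ih =>
    intro I X ha hcard hsize hinv hfaith hdich
    have hapos : 0 < a.factorial := Nat.factorial_pos a
    by_cases h1 : ∃ Bj ∈ I, ∀ x ∈ X, ∀ u ∈ Bj, x u = u
    · ---------------------------------------------------------------- (i) a block with trivial action
      obtain ⟨Bj, hBj, htriv⟩ := h1
      set I' := I.erase Bj with hI'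
      have hI'card : I'.card = k := by rw [hI', Finset.card_erase_of_mem hBj, hcard]; rfl
      have hmemI' : ∀ B, B ∈ I' ↔ B ≠ Bj ∧ B ∈ I := fun B => Finset.mem_erase
      have hIH := ih I' X ha hI'card (fun B hB => hsize B ((hmemI' B).1 hB).2)
        (fun x hx B hB => hinv x hx B ((hmemI' B).1 hB).2)
        (fun x hx hx' => hfaith x hx fun B hB => by
          by_cases hBj' : B = Bj
          · subst hBj'; exact htriv x hx
          · exact hx' B ((hmemI' B).2 ⟨hBj', hB⟩))
        (fun B hB => hdich B ((hmemI' B).1 hB).2)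
      refine hIH.trans (Nat.pow_le_pow_right hapos ?_)
      have hsub : (I'.filter fun B => ∃ x ∈ X, x ≠ 1 ∧ ∀ B' ∈ I', B' ≠ B → ∀ u ∈ B', x u = u) ⊆
          (I.filter fun B => ∃ x ∈ X, x ≠ 1 ∧ ∀ B' ∈ I, B' ≠ B → ∀ u ∈ B', x u = u) := by
        intro B hB
        rw [Finset.mem_filter] at hB ⊢
        obtain ⟨hBI', x, hx, hx1, hxt⟩ := hB
        refine ⟨((hmemI' B).1 hBI').2, x, hx, hx1, fun B' hB' hB'B => ?_⟩
        by_cases hB'j : B' = Bj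
        · subst hB'j; exact htriv x hx
        · exact hxt B' ((hmemI' B').2 ⟨hB'j, hB'⟩) hB'B
      have := Finset.card_le_card hsub
      omega
    · push Not at h1
      -- every block carries a non-trivial action, hence a full one
      have hfullall : ∀ B ∈ I, ∀ σ : Perm β, sign σ = 1 → (∀ u, σ u ≠ u → u ∈ B) →
          ∃ x ∈ X, ∀ u ∈ B, x u = σ u := by
        intro B hB
        rcases hdich B hB with h | h
        · obtain ⟨x, hx, u, hu, hxu⟩ := h1 B hB
          exact absurd (h x hx u hu) hxu
        · exact h
      by_cases h2 : ∃ Bj ∈ I, ∃ x ∈ X, x ≠ 1 ∧ ∀ B' ∈ I, B' ≠ Bj → ∀ u ∈ B', x u = u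
      · -------------------------------------------------------------- (ii) a good block: fixator
        obtain ⟨Bj, hBj, hgood⟩ := h2
        set X' := X ⊓ fixingSubgroup (Perm β) (Bj : Set β) with hX'
        have hmemX' : ∀ x, x ∈ X' ↔ x ∈ X ∧ ∀ u ∈ Bj, x u = u := by
          intro x
          rw [hX', Subgroup.mem_inf, mem_fixingSubgroup_iff]
          exact Iff.rfl
        have hcount : Nat.card X ≤ a.factorial * Nat.card X' := by
          have := card_le_factorial_mul_card_inf_fixing X Bj (fun x hx => hinv x hx Bj hBj)
          rwa [hsize Bj hBj] at this
        set I' := I.erase Bj with hI'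
        have hI'card : I'.card = k := by rw [hI', Finset.card_erase_of_mem hBj, hcard]; rfl
        have hmemI' : ∀ B, B ∈ I' ↔ B ≠ Bj ∧ B ∈ I := fun B => Finset.mem_erase
        have hIH := ih I' X' ha hI'card (fun B hB => hsize B ((hmemI' B).1 hB).2)
          (fun x hx B hB => hinv x ((hmemX' x).1 hx).1 B ((hmemI' B).1 hB).2)
          (fun x hx hx' => hfaith x ((hmemX' x).1 hx).1 fun B hB => by
            by_cases hBj' : B = Bj
            · subst hBj'; exact ((hmemX' x).1 hx).2
            · exact hx' B ((hmemI' B).2 ⟨hBj', hB⟩))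
          (fun B hB => by
            have hBI := ((hmemI' B).1 hB).2
            exact est_trivial_or_full_of_normal B X X' (hsize B hBI ▸ ha)
              (fun l hl => hinv l hl B hBI) (fun m hm => hinv m ((hmemX' m).1 hm).1 B hBI)
              (hfullall B hBI) (by
                intro l hl m hm
                rw [hmemX'] at hm ⊢
                refine ⟨X.mul_mem (X.mul_mem hl hm.1) (X.inv_mem hl), fun u hu => ?_⟩
                have h1 : l⁻¹ u ∈ Bj := inv_apply_mem_of_mem (fun x hx => hinv x hx Bj hBj) hl hu
                rw [Perm.mul_apply, Perm.mul_apply, hm.2 _ h1, perm_apply_inv_self]))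
        -- the good blocks of `X'` in `I'` are good blocks of `X` in `I` other than `B_j`
        have hsub : (I'.filter fun B => ∃ x ∈ X', x ≠ 1 ∧ ∀ B' ∈ I', B' ≠ B → ∀ u ∈ B', x u = u) ⊆
            (I.filter fun B => ∃ x ∈ X, x ≠ 1 ∧ ∀ B' ∈ I, B' ≠ B → ∀ u ∈ B', x u = u).erase Bj := by
          intro B hB
          rw [Finset.mem_filter] at hB
          rw [Finset.mem_erase, Finset.mem_filter]
          obtain ⟨hBI', x, hx, hx1, hxt⟩ := hB
          refine ⟨((hmemI' B).1 hBI').1, ((hmemI' B).1 hBI').2, x, ((hmemX' x).1 hx).1, hx1,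
            fun B' hB' hB'B => ?_⟩
          by_cases hB'j : B' = Bj
          · subst hB'j; exact ((hmemX' x).1 hx).2
          · exact hxt B' ((hmemI' B').2 ⟨hB'j, hB'⟩) hB'B
        have hgoodmem : Bj ∈ (I.filter fun B => ∃ x ∈ X, x ≠ 1 ∧ ∀ B' ∈ I, B' ≠ B → ∀ u ∈ B', x u = u) :=
          Finset.mem_filter.2 ⟨hBj, hgood⟩
        have hle := Finset.card_le_card hsub
        rw [Finset.card_erase_of_mem hgoodmem] at hle
        have hpos : 0 < (I.filter fun B => ∃ x ∈ X, x ≠ 1 ∧ ∀ B' ∈ I, B' ≠ B → ∀ u ∈ B', x u = u).card :=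
          Finset.card_pos.2 ⟨Bj, hgoodmem⟩
        calc Nat.card X ^ 2 ≤ (a.factorial * Nat.card X') ^ 2 := Nat.pow_le_pow_left hcount 2
          _ = a.factorial ^ 2 * Nat.card X' ^ 2 := mul_pow _ _ _
          _ ≤ a.factorial ^ 2 * a.factorial ^ (k +
              (I'.filter fun B => ∃ x ∈ X', x ≠ 1 ∧ ∀ B' ∈ I', B' ≠ B → ∀ u ∈ B', x u = u).card) :=
              Nat.mul_le_mul_left _ hIH
          _ ≤ a.factorial ^ (k + 1 + (I.filter fun B => ∃ x ∈ X, x ≠ 1 ∧ ∀ B' ∈ I, B' ≠ B → ∀ u ∈ B', x u = u).card) := by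
              rw [← pow_add]
              exact Nat.pow_le_pow_right hapos (by omega)
      · -------------------------------------------------------------- (iii) all blocks linked
        have h2' : ∀ Bj ∈ I, ¬ ∃ x ∈ X, x ≠ 1 ∧ ∀ B' ∈ I, B' ≠ Bj → ∀ u ∈ B', x u = u :=
          fun Bj hBj h => h2 ⟨Bj, hBj, h⟩
        have hg0 : (I.filter fun B => ∃ x ∈ X, x ≠ 1 ∧ ∀ B' ∈ I, B' ≠ B → ∀ u ∈ B', x u = u).card = 0 := by
          rw [Finset.card_eq_zero, Finset.filter_eq_empty_iff]
          intro Bj hBj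
          exact h2' Bj hBj
        obtain ⟨Bj, hBj⟩ : I.Nonempty := Finset.card_pos.1 (by omega)
        set I' := I.erase Bj with hI'
        have hI'card : I'.card = k := by rw [hI', Finset.card_erase_of_mem hBj, hcard]; rfl
        have hmemI' : ∀ B, B ∈ I' ↔ B ≠ Bj ∧ B ∈ I := fun B => Finset.mem_erase
        have hnotj : ∀ x ∈ X, (∀ B ∈ I, B ≠ Bj → ∀ u ∈ B, x u = u) → x = 1 := by
          intro x hx hxt
          by_contra hx1
          exact h2' Bj hBj ⟨x, hx, hx1, hxt⟩
        have hIH := ih I' X ha hI'card (fun B hB => hsize B ((hmemI' B).1 hB).2)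
          (fun x hx B hB => hinv x hx B ((hmemI' B).1 hB).2)
          (fun x hx hx' => hnotj x hx fun B hB hBj' => hx' B ((hmemI' B).2 ⟨hBj', hB⟩))
          (fun B hB => hdich B ((hmemI' B).1 hB).2)
        -- at most one good block appears
        have hle1 : (I'.filter fun B => ∃ x ∈ X, x ≠ 1 ∧ ∀ B' ∈ I', B' ≠ B → ∀ u ∈ B', x u = u).card
            ≤ 1 := by
          refine Finset.card_le_one.2 fun Bi hBi Bi' hBi' => ?_
          rw [Finset.mem_filter] at hBi hBi'
          obtain ⟨hBiI', xi, hxi, hxi1, hxit⟩ := hBi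
          obtain ⟨hBi'I', xi', hxi', hxi'1, hxi't⟩ := hBi'
          have hmv : ∀ (C : Finset β) (y : Perm β), C ∈ I' → y ∈ X → y ≠ 1 →
              (∀ B' ∈ I', B' ≠ C → ∀ u ∈ B', y u = u) → ∃ u ∈ Bj, y u ≠ u := by
            intro C y hC hy hy1 hyt
            by_contra hcon
            push Not at hcon
            refine h2' C ((hmemI' C).1 hC).2 ⟨y, hy, hy1, fun B' hB' hB'C => ?_⟩
            by_cases hB'j : B' = Bj
            · subst hB'j; exact hcon
            · exact hyt B' ((hmemI' B').2 ⟨hB'j, hB'⟩) hB'C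
          exact good_unique a ha I X hsize hinv Bj hBj (hfullall Bj hBj) hnotj Bi Bi'
            ((hmemI' Bi).1 hBiI').2 ((hmemI' Bi').1 hBi'I').2 ((hmemI' Bi).1 hBiI').1
            ((hmemI' Bi').1 hBi'I').1 xi hxi
            (fun B hB hB1 hB2 => hxit B ((hmemI' B).2 ⟨hB2, hB⟩) hB1) (hmv Bi xi hBiI' hxi hxi1 hxit)
            xi' hxi' (fun B hB hB1 hB2 => hxi't B ((hmemI' B).2 ⟨hB2, hB⟩) hB1)
            (hmv Bi' xi' hBi'I' hxi' hxi'1 hxi't)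
        refine hIH.trans (Nat.pow_le_pow_right hapos ?_)
        rw [hg0]
        omega

open EST in
/-- **The linkage count without good blocks**: in the setting of `est_linkage_sq_le`, if no block
is good then `|X|² ≤ (a!)^{|I|}`. -/
theorem est_linkage_sq_le_of_no_good :
    ∀ {β : Type*} [Fintype β] [DecidableEq β] (a k : ℕ) (I : Finset (Finset β))
      (X : Subgroup (Equiv.Perm β)),
      5 ≤ a → I.card = k → (∀ B ∈ I, B.card = a) → (∀ x ∈ X, ∀ B ∈ I, ∀ u, x u ∈ B ↔ u ∈ B) →
      (∀ x ∈ X, (∀ B ∈ I, ∀ u ∈ B, x u = u) → x = 1) →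
      (∀ B ∈ I, (∀ x ∈ X, ∀ u ∈ B, x u = u) ∨
        ∀ σ : Equiv.Perm β, Equiv.Perm.sign σ = 1 → (∀ u, σ u ≠ u → u ∈ B) →
          ∃ x ∈ X, ∀ u ∈ B, x u = σ u) →
      (∀ B ∈ I, ∀ x ∈ X, x ≠ 1 → (∀ B' ∈ I, B' ≠ B → ∀ u ∈ B', x u = u) → False) →
      Nat.card X ^ 2 ≤ a.factorial ^ k := by
  intro β _ _ a k I X ha hcard hsize hinv hfaith hdich hno
  have h := est_linkage_sq_le a k I X ha hcard hsize hinv hfaith hdich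
  rwa [Finset.card_eq_zero.2 (Finset.filter_eq_empty_iff.2 fun B hB hgood => ?_), add_zero] at h
  obtain ⟨x, hx, hx1, hxt⟩ := hgood
  exact hno B hB x hx hx1 hxt

end Summit.PneNP.PneNP.Theorems
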